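import Mathlib

/-!
# R-T rung, `J₅`, `μ₂`-vertex: the twisted-root cover polynomials `î`, `ĵ`, `Φ = 2î + ĵ` (definitions)

(crux stmt-ResolutionOfSingularities-15640 `WildQuotients.WildQuotientResolution`, line `Sketch`,
sector `|G| = p`; RUNG V5 of `L/w45c/CHAIN.md` v8.1, brick B7/`HP₂` step (α) (res-L1-w45c-plan-1
RULING 2026-08-27T11:12Z), design of record res-L1-w45c-idea-2 `W2-DESIGN.md` §6 (sha16
400ebbeeb3422d46) = res-type-036 PROPOSAL 2026-08-27T11:25:02Z (kit j277185), ADOPTED by the W₂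
term owner res-L1-w45c-stub-1 (2026-08-27T11:40:09Z, `JordanFive.chartW₂`, p528290); smoothness
certificate = idea-2's weighted Euler identity (`W2Euler.lean` b79f004da20cc391 = kit j277625).
[OURS · L1 W4.5c] — NOT a statement of any manuscript; replaces the role of no printed item.
Prover res-type-036 (owner of (α)). DEFINITIONS FILE: three polynomial FUNCTIONS of six ring
elements, valid in every commutative ring, plus their `ring` identities; no scheme, no instance,
no notation.)

On the twisted-root cover of `W₂ = D₊(i₂³t) ⊓ D₊((2j₃)²t)` (`s² = −j₃/i₂`), with
`x_a = s⁴Y₀, x_b = s³Y₁, x_c = s²Y₂, x_d = sY₃, x_e = Y₄`: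
* `coverIHat s Y₀ Y₁ Y₂ Y₃ Y₄ = î = i₂(x)/s⁴`, `coverJHat … = ĵ = (2j₃)(x)/s⁶` (dictionary lemmas
  `pow_four_mul_coverIHat`, `pow_six_mul_coverJHat` against stub-1's `iTwo`/`jThreeTwo` expansions);
* `coverPhi … = Φ = 2î + ĵ` — the cover equation (`s²·i₂ + j₃ = 0` divided by `s⁶`);
* invariance under the lifted action `σ_U : Y₁ ↦ Y₁ + sY₀, Y₂ ↦ Y₂ + sY₁, Y₃ ↦ Y₃ + sY₂,
  Y₄ ↦ Y₄ + sY₃` (`coverIHat_sigma`, `coverJHat_sigma`, `coverPhi_sigma`) and under the deck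
  involution `τ = (−s, Y₀, −Y₁, Y₂, −Y₃, Y₄)` (`coverIHat_tau`, `coverJHat_tau`, `coverPhi_tau`);
* `map_coverIHat/JHat/Phi` — compatibility with ring homomorphisms (so `σ_U Φ = Φ` etc. read off
  the laws of ANY endomorphism);
* `four_mul_coverIHat_eq` — the EULER SMOOTHNESS CERTIFICATE
  `4î = 6Φ + s·Φ_s − 4Y₀·Φ₀ − 3Y₁·Φ₁ − 2Y₂·Φ₂ − Y₃·Φ₃` with the five partial derivatives spelled out
  (weights `(s; Y₀..Y₄) = (1; 0,1,2,3,4)`: `î`, `ĵ` weighted-homogeneous of degrees `4`, `6`);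
* `coverIHat_mem_span` — `î ∈ (Y₀, Y₁, Y₂, Y₃)` (the unit that makes `aug(σ_U) = (s)` on `W₂`,
  `JordanFive.mu2Cover_augIdeal_eq_span_s`);
* `coverPhi_core` — on the core `s = Y₀ = Y₁ = Y₃ = 0`: `Φ = 2Y₂²(1 − Y₂)`;
* `coverPhi_eq_lin_mul_add`, `coverPhi_lin_eq`, `coverPhi_zero_zero` — `Φ` is linear in `Y₄` with
  coefficient `L = (4 + 12Y₂ + 6sY₁)Y₀ − 6Y₁²` (linear in `Y₀`), and `Φ|_{Y₄=0}(Y₀=Y₁=0) = 2Y₂²(1−Y₂)`: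
  the data of the irreducibility proof of `Φ` (degree one in `Y₄`, relatively prime coefficients).
-/

-- single-problem summit: the doubled namespace component `ResolutionOfSingularities` is forced
set_option linter.dupNamespace false

noncomputable section

namespace Summit.ResolutionOfSingularities.ResolutionOfSingularities.Theorems.WildQuotientResolution.JordanFive

variable {R : Type*} [CommRing R]

/-- `î(s; Y₀,…,Y₄) = i₂(s⁴Y₀, s³Y₁, s²Y₂, sY₃, Y₄)/s⁴` — the first twisted-root-cover invariant of
the `μ₂`-vertex of `J₅` (W2-DESIGN §6). [OURS · L1 W4.5c] -/
def coverIHat (s Y₀ Y₁ Y₂ Y₃ Y₄ : R) : R :=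
  Y₂ ^ 2 - s * Y₁ * Y₂ - 2 * Y₁ * Y₃ + s ^ 2 * Y₀ * Y₂ + 3 * s * Y₀ * Y₃ + 2 * Y₀ * Y₄

/-- `ĵ(s; Y₀,…,Y₄) = (2j₃)(s⁴Y₀, s³Y₁, s²Y₂, sY₃, Y₄)/s⁶` — the second twisted-root-cover invariant
(W2-DESIGN §6; `2j₃ = jThreeTwo` of stub-1). [OURS · L1 W4.5c] -/
def coverJHat (s Y₀ Y₁ Y₂ Y₃ Y₄ : R) : R :=
  -2 * Y₂ ^ 3 + 3 * s * Y₁ * Y₂ ^ 2 + 6 * Y₁ * Y₂ * Y₃ - s ^ 2 * Y₁ ^ 2 * Y₂ - 6 * s * Y₁ ^ 2 * Y₃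
    - 6 * Y₁ ^ 2 * Y₄ + s ^ 3 * Y₀ * Y₁ * Y₂ + 6 * s ^ 2 * Y₀ * Y₁ * Y₃ + 6 * s * Y₀ * Y₁ * Y₄
    - 2 * s ^ 2 * Y₀ * Y₂ ^ 2 + 12 * Y₀ * Y₂ * Y₄ - 9 * Y₀ * Y₃ ^ 2

/-- `Φ = 2î + ĵ` — the equation of the twisted-root cover `U₂ = {Φ = 0} ∩ {î ≠ 0}` of `W₂`
(`s² = −j₃/i₂ ⇔ s²·i₂ + j₃ = 0 ⇔ 2î + ĵ = 0` after division by `s⁶`). [OURS · L1 W4.5c] -/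
def coverPhi (s Y₀ Y₁ Y₂ Y₃ Y₄ : R) : R :=
  2 * coverIHat s Y₀ Y₁ Y₂ Y₃ Y₄ + coverJHat s Y₀ Y₁ Y₂ Y₃ Y₄

section Identities

variable (s Y₀ Y₁ Y₂ Y₃ Y₄ : R)

/-- Unfolding lemma for `coverPhi`. [OURS · L1 W4.5c] -/
theorem coverPhi_def : coverPhi s Y₀ Y₁ Y₂ Y₃ Y₄ =
    2 * coverIHat s Y₀ Y₁ Y₂ Y₃ Y₄ + coverJHat s Y₀ Y₁ Y₂ Y₃ Y₄ := rfl

/-- Dictionary: `s⁴·î = i₂(x)` for `x = (s⁴Y₀, s³Y₁, s²Y₂, sY₃, Y₄)`, with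
`i₂ = x_c² − x_bx_c − 2x_bx_d + x_ax_c + 3x_ax_d + 2x_ax_e` (stub-1's `JordanFive.iTwo` expansion).
[OURS · L1 W4.5c] -/
theorem pow_four_mul_coverIHat :
    s ^ 4 * coverIHat s Y₀ Y₁ Y₂ Y₃ Y₄ =
      (s ^ 2 * Y₂) ^ 2 - (s ^ 3 * Y₁) * (s ^ 2 * Y₂) - 2 * ((s ^ 3 * Y₁) * (s * Y₃))
        + (s ^ 4 * Y₀) * (s ^ 2 * Y₂) + 3 * ((s ^ 4 * Y₀) * (s * Y₃)) + 2 * ((s ^ 4 * Y₀) * Y₄) := by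
  unfold coverIHat; ring

/-- Dictionary: `s⁶·ĵ = (2j₃)(x)` for `x = (s⁴Y₀, s³Y₁, s²Y₂, sY₃, Y₄)`, with `2j₃ = jThreeTwo`
`= −2x_c³ + 3x_bx_c² + 6x_bx_cx_d − x_b²x_c − 6x_b²x_d − 6x_b²x_e + x_ax_bx_c + 6x_ax_bx_d + 6x_ax_bx_e
− 2x_ax_c² + 12x_ax_cx_e − 9x_ax_d²`. [OURS · L1 W4.5c] -/
theorem pow_six_mul_coverJHat :
    s ^ 6 * coverJHat s Y₀ Y₁ Y₂ Y₃ Y₄ =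
      -2 * (s ^ 2 * Y₂) ^ 3 + 3 * ((s ^ 3 * Y₁) * (s ^ 2 * Y₂) ^ 2)
        + 6 * ((s ^ 3 * Y₁) * (s ^ 2 * Y₂) * (s * Y₃)) - (s ^ 3 * Y₁) ^ 2 * (s ^ 2 * Y₂)
        - 6 * ((s ^ 3 * Y₁) ^ 2 * (s * Y₃)) - 6 * ((s ^ 3 * Y₁) ^ 2 * Y₄)
        + (s ^ 4 * Y₀) * (s ^ 3 * Y₁) * (s ^ 2 * Y₂) + 6 * ((s ^ 4 * Y₀) * (s ^ 3 * Y₁) * (s * Y₃))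
        + 6 * ((s ^ 4 * Y₀) * (s ^ 3 * Y₁) * Y₄) - 2 * ((s ^ 4 * Y₀) * (s ^ 2 * Y₂) ^ 2)
        + 12 * ((s ^ 4 * Y₀) * (s ^ 2 * Y₂) * Y₄) - 9 * ((s ^ 4 * Y₀) * (s * Y₃) ^ 2) := by
  unfold coverJHat; ring

/-- **`σ_U`-invariance of `î`** for the lifted action `Y₁ ↦ Y₁ + sY₀, Y₂ ↦ Y₂ + sY₁, Y₃ ↦ Y₃ + sY₂,
Y₄ ↦ Y₄ + sY₃` (`s`, `Y₀` fixed). [OURS · L1 W4.5c; kit j277185] -/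
theorem coverIHat_sigma :
    coverIHat s Y₀ (Y₁ + s * Y₀) (Y₂ + s * Y₁) (Y₃ + s * Y₂) (Y₄ + s * Y₃) =
      coverIHat s Y₀ Y₁ Y₂ Y₃ Y₄ := by
  unfold coverIHat; ring

/-- **`σ_U`-invariance of `ĵ`.** [OURS · L1 W4.5c; kit j277185] -/
theorem coverJHat_sigma :
    coverJHat s Y₀ (Y₁ + s * Y₀) (Y₂ + s * Y₁) (Y₃ + s * Y₂) (Y₄ + s * Y₃) =
      coverJHat s Y₀ Y₁ Y₂ Y₃ Y₄ := by
  unfold coverJHat; ring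

/-- **`σ_U`-invariance of the cover equation `Φ`.** [OURS · L1 W4.5c; kit j277185] -/
theorem coverPhi_sigma :
    coverPhi s Y₀ (Y₁ + s * Y₀) (Y₂ + s * Y₁) (Y₃ + s * Y₂) (Y₄ + s * Y₃) =
      coverPhi s Y₀ Y₁ Y₂ Y₃ Y₄ := by
  unfold coverPhi; rw [coverIHat_sigma, coverJHat_sigma]

/-- `τ`-invariance of `î` for the deck involution `(−s, Y₀, −Y₁, Y₂, −Y₃, Y₄)`. [OURS · L1 W4.5c] -/
theorem coverIHat_tau : coverIHat (-s) Y₀ (-Y₁) Y₂ (-Y₃) Y₄ = coverIHat s Y₀ Y₁ Y₂ Y₃ Y₄ := by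
  unfold coverIHat; ring

/-- `τ`-invariance of `ĵ`. [OURS · L1 W4.5c] -/
theorem coverJHat_tau : coverJHat (-s) Y₀ (-Y₁) Y₂ (-Y₃) Y₄ = coverJHat s Y₀ Y₁ Y₂ Y₃ Y₄ := by
  unfold coverJHat; ring

/-- `τ`-invariance of `Φ`. [OURS · L1 W4.5c] -/
theorem coverPhi_tau : coverPhi (-s) Y₀ (-Y₁) Y₂ (-Y₃) Y₄ = coverPhi s Y₀ Y₁ Y₂ Y₃ Y₄ := by
  unfold coverPhi; rw [coverIHat_tau, coverJHat_tau]

/-- `î` commutes with ring homomorphisms. [folklore] -/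
theorem map_coverIHat {S : Type*} [CommRing S] (f : R →+* S) :
    f (coverIHat s Y₀ Y₁ Y₂ Y₃ Y₄) = coverIHat (f s) (f Y₀) (f Y₁) (f Y₂) (f Y₃) (f Y₄) := by
  unfold coverIHat
  simp only [map_add, map_sub, map_mul, map_pow, map_ofNat]

/-- `ĵ` commutes with ring homomorphisms. [folklore] -/
theorem map_coverJHat {S : Type*} [CommRing S] (f : R →+* S) :
    f (coverJHat s Y₀ Y₁ Y₂ Y₃ Y₄) = coverJHat (f s) (f Y₀) (f Y₁) (f Y₂) (f Y₃) (f Y₄) := by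
  unfold coverJHat
  simp only [map_add, map_sub, map_mul, map_pow, map_neg, map_ofNat]

/-- `Φ` commutes with ring homomorphisms. [folklore] -/
theorem map_coverPhi {S : Type*} [CommRing S] (f : R →+* S) :
    f (coverPhi s Y₀ Y₁ Y₂ Y₃ Y₄) = coverPhi (f s) (f Y₀) (f Y₁) (f Y₂) (f Y₃) (f Y₄) := by
  unfold coverPhi
  rw [map_add, map_mul, map_ofNat, map_coverIHat, map_coverJHat]

/-- **The Euler smoothness certificate** (res-L1-w45c-idea-2 `W2Euler.four_ihat_eq`, kit j277625):
`4·î = 6·Φ + s·∂ₛΦ − 4Y₀·∂₀Φ − 3Y₁·∂₁Φ − 2Y₂·∂₂Φ − Y₃·∂₃Φ` with the five partial derivatives of `Φ`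
written out; hence at a prime containing `Φ` but not `î` (and `4 ≠ 0`) some partial derivative of
`Φ` is not in the prime (Jacobian criterion input for `U₂` regular). [OURS · L1 W4.5c] -/
theorem four_mul_coverIHat_eq :
    4 * coverIHat s Y₀ Y₁ Y₂ Y₃ Y₄ =
      6 * coverPhi s Y₀ Y₁ Y₂ Y₃ Y₄
      + s * (-2 * Y₁ * Y₂ + 3 * Y₁ * Y₂ ^ 2 - 6 * Y₁ ^ 2 * Y₃ + 6 * Y₀ * Y₃ + 6 * Y₀ * Y₁ * Y₄
          - 2 * s * Y₁ ^ 2 * Y₂ + 4 * s * Y₀ * Y₂ - 4 * s * Y₀ * Y₂ ^ 2 + 12 * s * Y₀ * Y₁ * Y₃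
          + 3 * s ^ 2 * Y₀ * Y₁ * Y₂)
      - 4 * Y₀ * (4 * Y₄ - 9 * Y₃ ^ 2 + 12 * Y₂ * Y₄ + 6 * s * Y₃ + 6 * s * Y₁ * Y₄ + 2 * s ^ 2 * Y₂
          - 2 * s ^ 2 * Y₂ ^ 2 + 6 * s ^ 2 * Y₁ * Y₃ + s ^ 3 * Y₁ * Y₂)
      - 3 * Y₁ * (-4 * Y₃ + 6 * Y₂ * Y₃ - 12 * Y₁ * Y₄ - 2 * s * Y₂ + 3 * s * Y₂ ^ 2
          - 12 * s * Y₁ * Y₃ + 6 * s * Y₀ * Y₄ - 2 * s ^ 2 * Y₁ * Y₂ + 6 * s ^ 2 * Y₀ * Y₃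
          + s ^ 3 * Y₀ * Y₂)
      - 2 * Y₂ * (4 * Y₂ - 6 * Y₂ ^ 2 + 6 * Y₁ * Y₃ + 12 * Y₀ * Y₄ - 2 * s * Y₁ + 6 * s * Y₁ * Y₂
          - s ^ 2 * Y₁ ^ 2 + 2 * s ^ 2 * Y₀ - 4 * s ^ 2 * Y₀ * Y₂ + s ^ 3 * Y₀ * Y₁)
      - Y₃ * (-4 * Y₁ + 6 * Y₁ * Y₂ - 18 * Y₀ * Y₃ - 6 * s * Y₁ ^ 2 + 6 * s * Y₀
          + 6 * s ^ 2 * Y₀ * Y₁) := by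
  unfold coverPhi coverIHat coverJHat; ring

/-- `î ∈ (Y₀, Y₁, Y₂, Y₃)`: every monomial of `î` contains one of `Y₀, Y₁, Y₂, Y₃` — so on
`W₂` (where `î` is a unit) the ideal `(Y₀, Y₁, Y₂, Y₃)` contains a unit, which is what makes the
augmentation ideal of `σ_U` equal to `(s)` (`JordanFive.mu2Cover_augIdeal_eq_span_s`).
[OURS · L1 W4.5c] -/
theorem coverIHat_mem_span :
    coverIHat s Y₀ Y₁ Y₂ Y₃ Y₄ ∈ Ideal.span ({Y₀, Y₁, Y₂, Y₃} : Set R) := by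
  have h0 : Y₀ ∈ Ideal.span ({Y₀, Y₁, Y₂, Y₃} : Set R) := Ideal.subset_span (by simp)
  have h1 : Y₁ ∈ Ideal.span ({Y₀, Y₁, Y₂, Y₃} : Set R) := Ideal.subset_span (by simp)
  have h2 : Y₂ ∈ Ideal.span ({Y₀, Y₁, Y₂, Y₃} : Set R) := Ideal.subset_span (by simp)
  have e : coverIHat s Y₀ Y₁ Y₂ Y₃ Y₄ =
      (Y₂ - s * Y₁ + s ^ 2 * Y₀) * Y₂ + (-2 * Y₃) * Y₁ + (3 * s * Y₃ + 2 * Y₄) * Y₀ := by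
    unfold coverIHat; ring
  rw [e]
  exact add_mem (add_mem (Ideal.mul_mem_left _ _ h2) (Ideal.mul_mem_left _ _ h1))
    (Ideal.mul_mem_left _ _ h0)

/-- On the core of the `μ₂`-vertex curve (`s = Y₀ = Y₁ = Y₃ = 0`): `Φ = 2Y₂²(1 − Y₂)` and `î = Y₂²`,
so `Y₂ = 1` there. [OURS · L1 W4.5c] -/
theorem coverPhi_core (Y₂ Y₄ : R) : coverPhi 0 0 0 Y₂ 0 Y₄ = 2 * Y₂ ^ 2 * (1 - Y₂) := by
  unfold coverPhi coverIHat coverJHat; ring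

/-- see `coverPhi_core`. -/
theorem coverIHat_core (Y₂ Y₄ : R) : coverIHat 0 0 0 Y₂ 0 Y₄ = Y₂ ^ 2 := by
  unfold coverIHat; ring

/-- **`Φ` is LINEAR in `Y₄`**: `Φ = L·Y₄ + Φ|_{Y₄ = 0}` with
`L = ∂Φ/∂Y₄ = 4Y₀ + 12Y₀Y₂ + 6sY₀Y₁ − 6Y₁²` (the irreducibility route for `(Φ)` prime: degree one in
`Y₄` with relatively prime coefficients). [OURS · L1 W4.5c] -/
theorem coverPhi_eq_lin_mul_add :
    coverPhi s Y₀ Y₁ Y₂ Y₃ Y₄ =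
      (4 * Y₀ + 12 * Y₀ * Y₂ + 6 * s * Y₀ * Y₁ - 6 * Y₁ ^ 2) * Y₄ + coverPhi s Y₀ Y₁ Y₂ Y₃ 0 := by
  unfold coverPhi coverIHat coverJHat; ring

/-- The `Y₄`-coefficient `L` is itself LINEAR in `Y₀`: `L = (4 + 12Y₂ + 6sY₁)·Y₀ − 6Y₁²`.
[OURS · L1 W4.5c] -/
theorem coverPhi_lin_eq (s Y₀ Y₁ Y₂ : R) :
    4 * Y₀ + 12 * Y₀ * Y₂ + 6 * s * Y₀ * Y₁ - 6 * Y₁ ^ 2 =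
      (4 + 12 * Y₂ + 6 * s * Y₁) * Y₀ - 6 * Y₁ ^ 2 := by
  ring

/-- `Φ|_{Y₄ = 0}` at `Y₀ = Y₁ = 0` is `2Y₂²(1 − Y₂)` — not zero, whereas `L` vanishes there: so `L ∤ Φ|_{Y₄=0}`.
[OURS · L1 W4.5c] -/
theorem coverPhi_zero_zero (Y₂ Y₃ : R) : coverPhi s 0 0 Y₂ Y₃ 0 = 2 * Y₂ ^ 2 * (1 - Y₂) := by
  unfold coverPhi coverIHat coverJHat; ring

end Identities

end Summit.ResolutionOfSingularities.ResolutionOfSingularities.Theorems.WildQuotientResolution.JordanFive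

end
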